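import Summits.QuantumFields.YangMills.Theorems.UnitScaleTiltFluctuationComparisonRegPrGlobalSlackKernelLegPerRunV4
import Summits.QuantumFields.YangMills.Theorems.UnitScaleTiltFluctuationComparisonRegPrGlobalSlackKernelLegWeighted
import HarnessLib

/-!
# `UnitScaleTiltFluctuationComparisonRegPrGlobalSlackKernelLegWeightedV4` — THE v4 TWIN (★★OWNER RULING g26-№14 (F-2b); P22b display branch, width seat ym-ust-20520-w2 g4; skeleton v5kD; record-free decls imported from `…KernelLegWeighted`) of `…KernelLegWeighted` — 3⁗χ WITH THE WEIGHTED OPERATOR-NORM KERNEL ROW (THE ROW (45) ACTUALLY CONSUMES), AND THAT ROW FROM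
# LEG-WEIGHTED ANALYTICITY BY CAUCHY ESTIMATES (crux `FluctuationComparisonRegPrIntL`, stmt-QuantumFields-20520, skeleton v5kC, STUB 3⁗χ; width seat ym-ust-20520-w1 g0, count-neutral)

WHY.  The leg-currency sockets of record (`K1aLegRowsRChiV4` and its per-run forms `K1aLegRowsRefChiV4` / `K1aLegRowsOwnChiV4`) carry print's (43) in its POINTWISE per-leg form
`KernelLegPointwiseΦ` and convert it to the weighted operator-norm row `KernelLegΦ` through leg summability with domain growth (`kernelLegΦ_of_pointwise_T`), PAYING half a unit of tree
decay (`κ := 𝔠.κ − ½`).  But `KernelLegΦ` — the operator norm of the flat kernel precomposed with the leg weights `D_w`, i.e. the kernel size of the RESCALED chart `Φ∘D_w`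
(`ker_rescaleW`) — is (i) what the chain consumes, (ii) single-run, and (iii) exactly what Cauchy estimates deliver from LEG-WEIGHTED ANALYTICITY of the chart: `Φ_{K,b,Y} ∘ D_w`
holomorphic and `≤ C_A·e^{−κ𝓛}` on the sup-ball of radius `ρ` — print's p.264 «for each variable B(c) there is a sequence of propagators connecting the bond c with the set X … the
factor exp(−δ₀ dist(c, X))» read as analyticity on the exponentially WIDENED polydisc `{x : sup_c e^{−κ′d(c)}‖x(c)‖ < ρ}`.  So:

* §1 **`kernelLegΦ_of_chartAnalyticLeg`**: `ChartAnalyticΦ D (rescaleΦw dist κ′ Φ) κ ρ C_A → KernelLegΦ D Φ dist κ′ κ (C_A·max(1,12/ρ)⁶)` (lane A's `kernelSizeΦ_of_chartAnalytic` on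
  the rescaled family + `ker_rescaleW`) — (43)-in-the-form-(45)-uses, at the record's FULL decay rate, from ONE displayed-type analyticity row; no pointwise row, no summability, no `−½`.
* §2 the socket **`K1aLegRowsEChiV4 L 𝔠 a₀ a₁ a`** (= `K1aLegRowsRChiV4` with `KernelLegPointwiseΦ … κ₁ 𝔠.κ A` replaced by `KernelLegΦ … κ′ 𝔠.κ C_E`), **`k1aChartRowsKChiV4_of_legRowsEChiV4`**
  (rescaled pair `(Φ∘D_w, D_w⁻¹B)`, decay `𝔠.κ` kept — NO letter, no loss) and the capstone **`globalTwoRunSlackFamChiV4_of_k1aLegRowsEChiV4 : … → ⟨3⁗χ TEXT VERBATIM⟩`**.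
* §3 the all-own per-run form **`K1aLegRowsOwnEChiV4`** (`KernelRefOwnΦ`, `KernelLegΦ`, `RemainderSmallOwnΦ`, `CfgDistOwnΦ`, `CfgRefOwnΦ`; reference objects before the (α) hypothesis)
  ⟹ `K1aLegRowsEChiV4` (`k1aLegRowsEChiV4_of_OwnEChiV4`, the geometry of `…KernelLegRefOwn` / `…KernelLegPerRun`) ⟹ ⟨3⁗χ⟩; and the DISPLAY-LEVEL form **`K1aLegRowsOwnAChiV4`** with the kernel
  row replaced by leg-weighted analyticity `ChartAnalyticΦ D (rescaleΦw (canonLegDist F) κ′ Φ) 𝔠.κ ρ C_A` ⟹ `K1aLegRowsOwnEChiV4` ⟹ ⟨3⁗χ⟩ (`globalTwoRunSlackFamChiV4_of_k1aLegRowsOwnAChiV4`).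
WHAT 3⁗χ NOW IS, BY NAME, AT DISPLAY LEVEL (`K1aLegRowsOwnAChiV4`; every row a `∀ K`-statement about ONE run): (R1) the birth charts' weighted flat kernels near a fixed height-free
reference family; (R2′) LEG-WEIGHTED ANALYTICITY of the charts with amplitude `C_A·e^{−𝔠.κ·𝓛}`; (R3) the seventh-order residual row for `residualRemRows` ((M1)+(57)); (R4) (44) in
distance form; (R5) the loop variables near a fixed coherent reference functional.  HONEST FRAMING: bookkeeping + Cauchy estimates over hypothesis schemas; nothing of
[Balaban1985UV3] / [King1986] is asserted; registry untouched; YM₃ on T³ is a rung, not the Clay problem / 𝕋⁴ / a mass gap.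

References: T. Bałaban, CMP 102 (1985) 255–275 [Balaban1985UV3] ((25) p.262, (29)–(30) p.263, (33)–(34) p.264, (43)–(45) pp.266–267, (57) p.270); C. King, CMP 102 (1986) 649–677
[King1986] (Thm 3.4 (3.9) p.656, (3.55)–(3.56) p.662, Prop. 3.9 (3.71)–(3.74) pp.664–665); S. B. Chae, Holomorphy and Calculus in Normed Spaces (1985) [Chae1985] (13.6).
-/

set_option autoImplicit false

noncomputable section

open scoped BigOperators
open Finset
open Literature.MathematicalPhysics.QuantumFieldTheory.Balaban1983to89
open Literature.MathematicalPhysics.QuantumFieldTheory.Balaban1983to89.T3ContinuumYM3Torus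
open Literature.MathematicalPhysics.QuantumFieldTheory.Balaban1983to89.T3UnitScaleTilt
open Literature.MathematicalPhysics.QuantumFieldTheory.Balaban1983to89.T3LevelShift
open Literature.MathematicalPhysics.QuantumFieldTheory.Balaban1983to89.T3AlphaInputsAC
open Literature.MathematicalPhysics.QuantumFieldTheory.Balaban1983to89.T3AlphaPolymerSocket
open Literature.MathematicalPhysics.QuantumFieldTheory.Balaban1983to89.T3AlphaInputsACTwoRun
open Literature.MathematicalPhysics.QuantumFieldTheory.Balaban1983to89.T3AlphaInputsACTwoRunLevel
open Literature.MathematicalPhysics.QuantumFieldTheory.Balaban1983to89.B12TreeDecay (kappa₀ kappa₀_nonneg)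
open Literature.MathematicalPhysics.QuantumFieldTheory.Balaban1985CMP102
open Literature.MathematicalPhysics.QuantumFieldTheory.Balaban1985CMP102.Setting
open Summit.QuantumFields.Balaban3D.Carriers
open Summit.QuantumFields.Balaban3D.Proofs.Primitives
open Summit.QuantumFields.Balaban3D.Proofs.GroupModelLieC (lieC)
open Summit.QuantumFields.Balaban3D.Proofs.Representation33 (jet26)
open Summit.QuantumFields.YangMills.Theorems
open Summit.QuantumFields.YangMills.Theorems.GlobalSlackKernelMatching
open Summit.QuantumFields.YangMills.Theorems.GlobalSlackCanonicalPolymers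

namespace Summit.QuantumFields.YangMills.Theorems.GlobalSlackKernelLeg

/-! ## §1 The weighted kernel row from leg-weighted analyticity -/

section Cauchy

variable {𝕍 : Type} [NormedAddCommGroup 𝕍] [NormedSpace ℂ 𝕍] {F : T3Family} {γ : ℝ}

-- (record-free `kernelLegΦ_of_chartAnalyticLeg`: imported from the v3 module, not restated)

end Cauchy

/-! ## §2 The socket with the weighted kernel row, and the registered text -/

/-- **THE K1a LEG ROWS WITH THE WEIGHTED OPERATOR-NORM KERNEL ROW** (hypothesis schema, never asserted): `K1aLegRowsRChiV4` with print's (43) carried as `KernelLegΦ … κ′ 𝔠.κ C_E`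
(the weighted operator norm the summation (45) uses) instead of the pointwise per-leg row — a weight rate `κ′ > 0`, nonnegative constants, a threshold, and for every family /
coupling / inhabited χ-package a coherent `p` and ONE `(Φ, e, B)` with K1a `FlatKernelLegCauchyΦ`, `KernelLegΦ`, the residual row, (44) `CfgDistΦ`, `CfgDistCauchyΦ`, all at the
record's full decay `𝔠.κ` and the canonical leg distance. [cite: Balaban1985UV3, (43)-(45) pp.266-267, (57) p.270; King1986, Thm 3.4 (3.9) p.656, Prop. 3.6 (3.56) p.662] -/
def K1aLegRowsEChiV4 (L : ℕ) (𝔠 : AlphaConsts L (suGroupModel 2).N) (a₀ a₁ a : ℝ) : Prop :=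
  ∃ (κ' C C_E C_R C_s C_B γB : ℝ), 0 < κ' ∧ 0 ≤ C ∧ 0 ≤ C_E ∧ 0 ≤ C_R ∧ 0 ≤ C_s ∧ 0 ≤ C_B ∧ 0 < γB ∧
    ∀ (F : T3Family) (γ : ℝ) (hF : F.L = L) (hγ : 0 < γ), γ ≤ γB → ∀ (hγ1 : γ ≤ (min (hF ▸ 𝔠).gamma0 1) ^ 2),
      AlphaInputsT3AC.OfV4ChiAt F (hF ▸ 𝔠) a₀ a₁ →
        ∃ (p : ∀ K, AlphaInputsT3AC.PkgAtV4Chi F (hF ▸ 𝔠) γ hγ hγ1 K), (∀ K, (p K).a₀ = a₀ ∧ (p K).a₁ = a₁) ∧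
          ∃ (Φ : ChartFam ↥(lieC (suGroupModel 2)) F) (e : VacFam F) (B : CfgFam ↥(lieC (suGroupModel 2)) F),
            FlatKernelLegCauchyΦ (AlphaInputsT3AC.dataOfV4chi p (canonPolymerRows fun K => (p K).toRows)) Φ (canonLegDist F) κ' (hF ▸ 𝔠).κ a C ∧
            KernelLegΦ (AlphaInputsT3AC.dataOfV4chi p (canonPolymerRows fun K => (p K).toRows)) Φ (canonLegDist F) κ' (hF ▸ 𝔠).κ C_E ∧
            RemainderSmallΦ (AlphaInputsT3AC.dataOfV4chi p (canonPolymerRows fun K => (p K).toRows)) (residualRemRows (fun K => (p K).toRows) Φ e B)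
              (hF ▸ 𝔠).b₀ (hF ▸ 𝔠).p₀ (hF ▸ 𝔠).κ C_R ∧
            CfgDistΦ (AlphaInputsT3AC.dataOfV4chi p (canonPolymerRows fun K => (p K).toRows)) B (canonLegDist F) (hF ▸ 𝔠).b₀ (hF ▸ 𝔠).p₀ C_s ∧
            CfgDistCauchyΦ (AlphaInputsT3AC.dataOfV4chi p (canonPolymerRows fun K => (p K).toRows)) B (canonLegDist F) (hF ▸ 𝔠).b₀ (hF ▸ 𝔠).p₀ a C_B

/-- **THE WEIGHTED LEG ROWS GIVE THE χ-CHART ROWS AT THE RECORD'S FULL DECAY `κ := 𝔠.κ`** — through the rescaled pair `(Φ∘D_w, D_w⁻¹B)` and the residual rest: `TaylorSplitΦ` by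
definition and invariance (`taylorSplitΦ_residualRows`, `taylorSplitΦ_rescaleW`), K1a and the kernel size transfer verbatim (`flatKernelCauchyΦ_rescaleW`, `kernelSizeΦ_rescaleW`),
the configuration rows at the SAME profile with constant `·(1 + κ′⁻¹)` (`cfgSizeΦ_rescaleW`, `cfgCauchyΦ_rescaleW`); no letter on the record, no loss of decay.
[cite: Balaban1985UV3, (43)-(45) pp.266-267; King1986, Prop. 3.6 (3.56) p.662] -/
theorem k1aChartRowsKChiV4_of_legRowsEChiV4 {L : ℕ} {𝔠 : AlphaConsts L (suGroupModel 2).N} {a₀ a₁ a : ℝ} (h : K1aLegRowsEChiV4 L 𝔠 a₀ a₁ a) :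
    K1aChartRowsKChiV4 L 𝔠 a₀ a₁ a := by
  obtain ⟨κ', C, C_E, C_R, C_s, C_B, γB, hκ', hC, hCE, hCR, hCs, hCB, hγB, hall⟩ := h
  have hk1 : 0 ≤ 1 + κ'⁻¹ := by positivity
  refine ⟨C, C_E, C_R, C_s * (1 + κ'⁻¹), C_B * (1 + κ'⁻¹), γB, hC, hCE, hCR, mul_nonneg hCs hk1, mul_nonneg hCB hk1, hγB,
    fun F γ hF hγ hγle hγ1 hOf => ?_⟩
  subst hF
  obtain ⟨p, hp, Φ, e, B, hK, hE, hR, hS, hBC⟩ := hall F γ rfl hγ hγle hγ1 hOf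
  have hL : 1 ≤ F.L := F.hL.2.le
  have hγ1' : γ ≤ 1 := hγ1.trans (sq_min_one_le _ 𝔠.gamma0_pos)
  have hn := canonLegDist_nonneg F
  have hm := canonLegDist_matched F
  exact ⟨p, hp, rescaleΦw (canonLegDist F) κ' Φ, e, rescaleBw (canonLegDist F) κ' B, residualRemRows (fun K => (p K).toRows) Φ e B,
    taylorSplitΦ_rescaleW (canonLegDist F) κ' (taylorSplitΦ_residualRows (fun K => (p K).toRows) Φ e B),
    flatKernelCauchyΦ_rescaleW hm hK, kernelSizeΦ_rescaleW hE, hR,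
    cfgSizeΦ_rescaleW hL hγ hγ1' 𝔠.b₀_pos hn hm hκ' hCs hS, cfgCauchyΦ_rescaleW hL hγ hγ1' 𝔠.b₀_pos hn hm hκ' hCB hBC⟩

/-- **THE REGISTERED STUB 3⁗χ FROM THE WEIGHTED LEG ROWS, BY NAME** (`globalTwoRunSlackFamChiV4_of_k1aChartRowsKChiV4 ∘ k1aChartRowsKChiV4_of_legRowsEChiV4`).
[cite: King1986, Thm 3.4 (3.9) p.656, Prop. 3.6 (3.56) p.662; Balaban1985UV3, (43)-(47) pp.266-267, (57) p.270] -/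
theorem globalTwoRunSlackFamChiV4_of_k1aLegRowsEChiV4
    (h : ∀ (L : ℕ), Odd L → 7 ≤ L → ∀ (𝔠 : AlphaConsts L (suGroupModel 2).N) (a₀ a₁ : ℝ), 0 < a₀ → 0 < a₁ → 𝔠.B₃ * a₁ ≤ a₀ →
      ∃ a : ℝ, 0 < a ∧ a < 1 ∧ K1aLegRowsEChiV4 L 𝔠 a₀ a₁ a) :
    ∀ (L : ℕ), Odd L → 7 ≤ L → ∀ (𝔠 : Summit.QuantumFields.Balaban3D.Proofs.Primitives.AlphaConsts L (Summit.QuantumFields.Balaban3D.Carriers.suGroupModel 2).N)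
      (a₀ a₁ : ℝ), 0 < a₀ → 0 < a₁ → 𝔠.B₃ * a₁ ≤ a₀ →
      ∃ a : ℝ, 0 < a ∧ ∃ γB : ℝ, 0 < γB ∧ ∀ (F : T3Family) (γ : ℝ) (hF : F.L = L) (hγ : 0 < γ), γ ≤ γB →
        ∀ (hγ1 : γ ≤ (min (hF ▸ 𝔠).gamma0 1) ^ 2),
          Summit.QuantumFields.YangMills.Theorems.AlphaInputsT3AC.OfV4ChiAt F (hF ▸ 𝔠) a₀ a₁ →
          ∃ (p : ∀ K, Summit.QuantumFields.YangMills.Theorems.AlphaInputsT3AC.PkgAtV4Chi F (hF ▸ 𝔠) γ hγ hγ1 K),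
            (∀ K, (p K).a₀ = a₀ ∧ (p K).a₁ = a₁) ∧
            ∃ (π : Summit.QuantumFields.YangMills.Theorems.AlphaInputsT3AC.PolymerT3 F) (σ : ℕ) (C : ℝ), 7 ≤ σ ∧ 0 ≤ C ∧
              Summit.QuantumFields.YangMills.Theorems.GlobalSlack.GlobalSupRateTSlack (Summit.QuantumFields.YangMills.Theorems.AlphaInputsT3AC.dataOfV4chi p π) (hF ▸ 𝔠).b₀ (hF ▸ 𝔠).p₀ a σ C :=
  globalTwoRunSlackFamChiV4_of_k1aChartRowsKChiV4 fun L hLo h7 𝔠 a₀ a₁ ha0 ha1 hw => by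
    obtain ⟨a, ha, ha1', hc⟩ := h L hLo h7 𝔠 a₀ a₁ ha0 ha1 hw
    exact ⟨a, ha, ha1', k1aChartRowsKChiV4_of_legRowsEChiV4 hc⟩

/-! ## §3 The all-own per-run forms: with the weighted kernel row, and with leg-weighted analyticity -/

/-- **3⁗χ PER RUN WITH THE WEIGHTED KERNEL ROW** (hypothesis schema, never asserted): `K1aLegRowsOwnChiV4` with `KernelLegPointwiseΦ` replaced by `KernelLegΦ … κ′ 𝔠.κ C_E` — five rows,
each a `∀ K`-statement about ONE run: `KernelRefOwnΦ`, `KernelLegΦ`, `RemainderSmallOwnΦ … (residualRemRows …)`, `CfgDistOwnΦ`, `CfgRefOwnΦ`; reference objects `Ψ` (height-free),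
`BR` (coherent) BEFORE the (α) hypothesis. [cite: King1986, Thm 3.4 (3.9) p.656, Prop. 3.6 (3.56) p.662, Prop. 3.9 (3.71)-(3.74) p.665; Balaban1985UV3, (43)-(45) pp.266-267, (57) p.270] -/
def K1aLegRowsOwnEChiV4 (L : ℕ) (𝔠 : AlphaConsts L (suGroupModel 2).N) (a₀ a₁ a : ℝ) : Prop :=
  ∃ (κ' C C_E C_R C_s C_B γB : ℝ), 0 < κ' ∧ 0 ≤ C ∧ 0 ≤ C_E ∧ 0 ≤ C_R ∧ 0 ≤ C_s ∧ 0 ≤ C_B ∧ 0 < γB ∧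
    ∀ (F : T3Family) (γ : ℝ) (hF : F.L = L) (hγ : 0 < γ), γ ≤ γB → ∀ (hγ1 : γ ≤ (min (hF ▸ 𝔠).gamma0 1) ^ 2),
      ∃ (Ψ : ChartFam ↥(lieC (suGroupModel 2)) F) (BR : CfgFam ↥(lieC (suGroupModel 2)) F), KerHeightFree Ψ ∧ RefCfgCoherent BR ∧
        (AlphaInputsT3AC.OfV4ChiAt F (hF ▸ 𝔠) a₀ a₁ →
          ∃ (p : ∀ K, AlphaInputsT3AC.PkgAtV4Chi F (hF ▸ 𝔠) γ hγ hγ1 K), (∀ K, (p K).a₀ = a₀ ∧ (p K).a₁ = a₁) ∧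
            ∃ (Φ : ChartFam ↥(lieC (suGroupModel 2)) F) (e : VacFam F) (B : CfgFam ↥(lieC (suGroupModel 2)) F),
              KernelRefOwnΦ (AlphaInputsT3AC.dataOfV4chi p (canonPolymerRows fun K => (p K).toRows)) Φ Ψ (canonLegDist F) κ' (hF ▸ 𝔠).κ a C ∧
              KernelLegΦ (AlphaInputsT3AC.dataOfV4chi p (canonPolymerRows fun K => (p K).toRows)) Φ (canonLegDist F) κ' (hF ▸ 𝔠).κ C_E ∧
              RemainderSmallOwnΦ (AlphaInputsT3AC.dataOfV4chi p (canonPolymerRows fun K => (p K).toRows)) (residualRemRows (fun K => (p K).toRows) Φ e B)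
                (hF ▸ 𝔠).b₀ (hF ▸ 𝔠).p₀ (hF ▸ 𝔠).κ C_R ∧
              CfgDistOwnΦ (AlphaInputsT3AC.dataOfV4chi p (canonPolymerRows fun K => (p K).toRows)) B (canonLegDist F) (hF ▸ 𝔠).b₀ (hF ▸ 𝔠).p₀ C_s ∧
              CfgRefOwnΦ (AlphaInputsT3AC.dataOfV4chi p (canonPolymerRows fun K => (p K).toRows)) B BR (canonLegDist F) (hF ▸ 𝔠).b₀ (hF ▸ 𝔠).p₀ a C_B)

/-- **THE ALL-OWN WEIGHTED FORM GIVES THE WEIGHTED SOCKET**: `K1aLegRowsOwnEChiV4 → K1aLegRowsEChiV4` (`0 ≤ a`; K1a by `flatKernelLegCauchyΦ_of_ref ∘ kernelRefΦ_canonRows_of_own`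
(constant `2C`), the residual and (44) rows by `remainderSmallΦ_canonRows_of_own` / `cfgDistΦ_canonRows_of_own`, `CfgDistCauchyΦ` by `cfgDistCauchyΦ_of_ref ∘ cfgRefΦ_canonRows_of_own`
(constant `2C_B`)). [cite: King1986, Prop. 3.6 (3.56) p.662, Prop. 3.9 (3.71)-(3.74) p.665; Balaban1985UV3, (24)-(25) p.262] -/
theorem k1aLegRowsEChiV4_of_OwnEChiV4 {L : ℕ} {𝔠 : AlphaConsts L (suGroupModel 2).N} {a₀ a₁ a : ℝ} (ha : 0 ≤ a) (h : K1aLegRowsOwnEChiV4 L 𝔠 a₀ a₁ a) :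
    K1aLegRowsEChiV4 L 𝔠 a₀ a₁ a := by
  obtain ⟨κ', C, C_E, C_R, C_s, C_B, γB, hκ', hC, hCE, hCR, hCs, hCB, hγB, hall⟩ := h
  refine ⟨κ', 2 * C, C_E, C_R, C_s, 2 * C_B, γB, hκ', by linarith, hCE, hCR, hCs, by linarith, hγB, fun F γ hF hγ hγle hγ1 hOf => ?_⟩
  obtain ⟨Ψ, BR, hΨ, hBR, himp⟩ := hall F γ hF hγ hγle hγ1
  obtain ⟨p, hp, Φ, e, B, hK, hE, hR, hS, hBC⟩ := himp hOf
  subst hF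
  have hκ0 : 0 ≤ 𝔠.κ := by
    have h0 : 0 ≤ kappa₀ (4 * 2 ^ 3) (2 * 3) := kappa₀_nonneg (by norm_num) _
    linarith [𝔠.kappa_ge]
  exact ⟨p, hp, Φ, e, B, flatKernelLegCauchyΦ_of_ref hΨ (kernelRefΦ_canonRows_of_own p hκ0 hC ha hK), hE,
    remainderSmallΦ_canonRows_of_own p hκ0 hCR hR, cfgDistΦ_canonRows_of_own p hS,
    cfgDistCauchyΦ_of_ref hBR (cfgRefΦ_canonRows_of_own p hCB ha hBC)⟩

/-- **3⁗χ PER RUN AT DISPLAY LEVEL** (hypothesis schema, never asserted): `K1aLegRowsOwnEChiV4` with the kernel row replaced by LEG-WEIGHTED ANALYTICITY of the charts —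
`ChartAnalyticΦ D (rescaleΦw (canonLegDist F) κ′ Φ) 𝔠.κ ρ C_A` (each chart, precomposed with the leg weights, holomorphic on `ball 0 ρ` and `≤ C_A·e^{−𝔠.κ·𝓛}` on the half ball;
print p.264: propagator chains from each leg to the domain) — the other four rows unchanged (`KernelRefOwnΦ`, `RemainderSmallOwnΦ`, `CfgDistOwnΦ`, `CfgRefOwnΦ`).
[cite: Balaban1985UV3, (25) p.262, (29)-(30) p.263, (33)-(34) p.264, (43)-(45) pp.266-267, (57) p.270; King1986, Prop. 3.6 (3.56) p.662] -/
def K1aLegRowsOwnAChiV4 (L : ℕ) (𝔠 : AlphaConsts L (suGroupModel 2).N) (a₀ a₁ a : ℝ) : Prop :=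
  ∃ (κ' ρ C C_A C_R C_s C_B γB : ℝ), 0 < κ' ∧ 0 < ρ ∧ 0 ≤ C ∧ 0 ≤ C_A ∧ 0 ≤ C_R ∧ 0 ≤ C_s ∧ 0 ≤ C_B ∧ 0 < γB ∧
    ∀ (F : T3Family) (γ : ℝ) (hF : F.L = L) (hγ : 0 < γ), γ ≤ γB → ∀ (hγ1 : γ ≤ (min (hF ▸ 𝔠).gamma0 1) ^ 2),
      ∃ (Ψ : ChartFam ↥(lieC (suGroupModel 2)) F) (BR : CfgFam ↥(lieC (suGroupModel 2)) F), KerHeightFree Ψ ∧ RefCfgCoherent BR ∧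
        (AlphaInputsT3AC.OfV4ChiAt F (hF ▸ 𝔠) a₀ a₁ →
          ∃ (p : ∀ K, AlphaInputsT3AC.PkgAtV4Chi F (hF ▸ 𝔠) γ hγ hγ1 K), (∀ K, (p K).a₀ = a₀ ∧ (p K).a₁ = a₁) ∧
            ∃ (Φ : ChartFam ↥(lieC (suGroupModel 2)) F) (e : VacFam F) (B : CfgFam ↥(lieC (suGroupModel 2)) F),
              KernelRefOwnΦ (AlphaInputsT3AC.dataOfV4chi p (canonPolymerRows fun K => (p K).toRows)) Φ Ψ (canonLegDist F) κ' (hF ▸ 𝔠).κ a C ∧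
              ChartAnalyticΦ (AlphaInputsT3AC.dataOfV4chi p (canonPolymerRows fun K => (p K).toRows)) (rescaleΦw (canonLegDist F) κ' Φ) (hF ▸ 𝔠).κ ρ C_A ∧
              RemainderSmallOwnΦ (AlphaInputsT3AC.dataOfV4chi p (canonPolymerRows fun K => (p K).toRows)) (residualRemRows (fun K => (p K).toRows) Φ e B)
                (hF ▸ 𝔠).b₀ (hF ▸ 𝔠).p₀ (hF ▸ 𝔠).κ C_R ∧
              CfgDistOwnΦ (AlphaInputsT3AC.dataOfV4chi p (canonPolymerRows fun K => (p K).toRows)) B (canonLegDist F) (hF ▸ 𝔠).b₀ (hF ▸ 𝔠).p₀ C_s ∧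
              CfgRefOwnΦ (AlphaInputsT3AC.dataOfV4chi p (canonPolymerRows fun K => (p K).toRows)) B BR (canonLegDist F) (hF ▸ 𝔠).b₀ (hF ▸ 𝔠).p₀ a C_B)

/-- **DISPLAY LEVEL GIVES THE WEIGHTED PER-RUN FORM**: `K1aLegRowsOwnAChiV4 → K1aLegRowsOwnEChiV4` with `C_E := C_A·max(1,12/ρ)⁶` (`kernelLegΦ_of_chartAnalyticLeg`).
[cite: Balaban1985UV3, Prop. 3 (34) p.264; Chae1985, 13.6] -/
theorem k1aLegRowsOwnEChiV4_of_OwnAChiV4 {L : ℕ} {𝔠 : AlphaConsts L (suGroupModel 2).N} {a₀ a₁ a : ℝ} (h : K1aLegRowsOwnAChiV4 L 𝔠 a₀ a₁ a) :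
    K1aLegRowsOwnEChiV4 L 𝔠 a₀ a₁ a := by
  obtain ⟨κ', ρ, C, C_A, C_R, C_s, C_B, γB, hκ', hρ, hC, hCA, hCR, hCs, hCB, hγB, hall⟩ := h
  refine ⟨κ', C, C_A * (max 1 (12 / ρ)) ^ 6, C_R, C_s, C_B, γB, hκ', hC, by positivity, hCR, hCs, hCB, hγB, fun F γ hF hγ hγle hγ1 => ?_⟩
  obtain ⟨Ψ, BR, hΨ, hBR, himp⟩ := hall F γ hF hγ hγle hγ1
  refine ⟨Ψ, BR, hΨ, hBR, fun hOf => ?_⟩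
  obtain ⟨p, hp, Φ, e, B, hK, hA, hR, hS, hBC⟩ := himp hOf
  exact ⟨p, hp, Φ, e, B, hK, kernelLegΦ_of_chartAnalyticLeg hA, hR, hS, hBC⟩

/-- **THE REGISTERED STUB 3⁗χ FROM THE ALL-OWN WEIGHTED FORM, BY NAME** (`globalTwoRunSlackFamChiV4_of_k1aLegRowsEChiV4 ∘ k1aLegRowsEChiV4_of_OwnEChiV4`).
[cite: King1986, Thm 3.4 (3.9) p.656, Prop. 3.6 (3.56) p.662; Balaban1985UV3, (43)-(47) pp.266-267, (57) p.270] -/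
theorem globalTwoRunSlackFamChiV4_of_k1aLegRowsOwnEChiV4
    (h : ∀ (L : ℕ), Odd L → 7 ≤ L → ∀ (𝔠 : AlphaConsts L (suGroupModel 2).N) (a₀ a₁ : ℝ), 0 < a₀ → 0 < a₁ → 𝔠.B₃ * a₁ ≤ a₀ →
      ∃ a : ℝ, 0 < a ∧ a < 1 ∧ K1aLegRowsOwnEChiV4 L 𝔠 a₀ a₁ a) :
    ∀ (L : ℕ), Odd L → 7 ≤ L → ∀ (𝔠 : Summit.QuantumFields.Balaban3D.Proofs.Primitives.AlphaConsts L (Summit.QuantumFields.Balaban3D.Carriers.suGroupModel 2).N)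
      (a₀ a₁ : ℝ), 0 < a₀ → 0 < a₁ → 𝔠.B₃ * a₁ ≤ a₀ →
      ∃ a : ℝ, 0 < a ∧ ∃ γB : ℝ, 0 < γB ∧ ∀ (F : T3Family) (γ : ℝ) (hF : F.L = L) (hγ : 0 < γ), γ ≤ γB →
        ∀ (hγ1 : γ ≤ (min (hF ▸ 𝔠).gamma0 1) ^ 2),
          Summit.QuantumFields.YangMills.Theorems.AlphaInputsT3AC.OfV4ChiAt F (hF ▸ 𝔠) a₀ a₁ →
          ∃ (p : ∀ K, Summit.QuantumFields.YangMills.Theorems.AlphaInputsT3AC.PkgAtV4Chi F (hF ▸ 𝔠) γ hγ hγ1 K),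
            (∀ K, (p K).a₀ = a₀ ∧ (p K).a₁ = a₁) ∧
            ∃ (π : Summit.QuantumFields.YangMills.Theorems.AlphaInputsT3AC.PolymerT3 F) (σ : ℕ) (C : ℝ), 7 ≤ σ ∧ 0 ≤ C ∧
              Summit.QuantumFields.YangMills.Theorems.GlobalSlack.GlobalSupRateTSlack (Summit.QuantumFields.YangMills.Theorems.AlphaInputsT3AC.dataOfV4chi p π) (hF ▸ 𝔠).b₀ (hF ▸ 𝔠).p₀ a σ C :=
  globalTwoRunSlackFamChiV4_of_k1aLegRowsEChiV4 fun L hLo h7 𝔠 a₀ a₁ ha0 ha1 hw => by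
    obtain ⟨a, ha, ha1', hc⟩ := h L hLo h7 𝔠 a₀ a₁ ha0 ha1 hw
    exact ⟨a, ha, ha1', k1aLegRowsEChiV4_of_OwnEChiV4 ha.le hc⟩

/-- **THE REGISTERED STUB 3⁗χ FROM THE DISPLAY-LEVEL PER-RUN FORM, BY NAME** (`… ∘ k1aLegRowsOwnEChiV4_of_OwnAChiV4`): five `∀ K`-rows about ONE run each — kernel closeness to a fixed
height-free reference, leg-weighted analyticity, the seventh-order residual row, (44) in distance form, loop-variable closeness to a fixed coherent reference — imply the text of
`stub_globalTwoRunSlackFamChiV4` VERBATIM. [cite: King1986, Thm 3.4 (3.9) p.656, Prop. 3.6 (3.56) p.662; Balaban1985UV3, (25) p.262, (43)-(47) pp.266-267, (57) p.270] -/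
theorem globalTwoRunSlackFamChiV4_of_k1aLegRowsOwnAChiV4
    (h : ∀ (L : ℕ), Odd L → 7 ≤ L → ∀ (𝔠 : AlphaConsts L (suGroupModel 2).N) (a₀ a₁ : ℝ), 0 < a₀ → 0 < a₁ → 𝔠.B₃ * a₁ ≤ a₀ →
      ∃ a : ℝ, 0 < a ∧ a < 1 ∧ K1aLegRowsOwnAChiV4 L 𝔠 a₀ a₁ a) :
    ∀ (L : ℕ), Odd L → 7 ≤ L → ∀ (𝔠 : Summit.QuantumFields.Balaban3D.Proofs.Primitives.AlphaConsts L (Summit.QuantumFields.Balaban3D.Carriers.suGroupModel 2).N)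
      (a₀ a₁ : ℝ), 0 < a₀ → 0 < a₁ → 𝔠.B₃ * a₁ ≤ a₀ →
      ∃ a : ℝ, 0 < a ∧ ∃ γB : ℝ, 0 < γB ∧ ∀ (F : T3Family) (γ : ℝ) (hF : F.L = L) (hγ : 0 < γ), γ ≤ γB →
        ∀ (hγ1 : γ ≤ (min (hF ▸ 𝔠).gamma0 1) ^ 2),
          Summit.QuantumFields.YangMills.Theorems.AlphaInputsT3AC.OfV4ChiAt F (hF ▸ 𝔠) a₀ a₁ →
          ∃ (p : ∀ K, Summit.QuantumFields.YangMills.Theorems.AlphaInputsT3AC.PkgAtV4Chi F (hF ▸ 𝔠) γ hγ hγ1 K),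
            (∀ K, (p K).a₀ = a₀ ∧ (p K).a₁ = a₁) ∧
            ∃ (π : Summit.QuantumFields.YangMills.Theorems.AlphaInputsT3AC.PolymerT3 F) (σ : ℕ) (C : ℝ), 7 ≤ σ ∧ 0 ≤ C ∧
              Summit.QuantumFields.YangMills.Theorems.GlobalSlack.GlobalSupRateTSlack (Summit.QuantumFields.YangMills.Theorems.AlphaInputsT3AC.dataOfV4chi p π) (hF ▸ 𝔠).b₀ (hF ▸ 𝔠).p₀ a σ C :=
  globalTwoRunSlackFamChiV4_of_k1aLegRowsOwnEChiV4 fun L hLo h7 𝔠 a₀ a₁ ha0 ha1 hw => by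
    obtain ⟨a, ha, ha1', hc⟩ := h L hLo h7 𝔠 a₀ a₁ ha0 ha1 hw
    exact ⟨a, ha, ha1', k1aLegRowsOwnEChiV4_of_OwnAChiV4 hc⟩

end Summit.QuantumFields.YangMills.Theorems.GlobalSlackKernelLeg

end
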